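import Mathlib.MeasureTheory.Measure.Haar.Unique
import Literature.NumberTheory.Automorphic.ArchRankinSelbergPairBridge
import Literature.NumberTheory.Automorphic.AdelicGLnGlueProofs
import HarnessLib

/-!
# Splitting a unit-box torus integral with a two-valued finite factor off its archimedean part

Topic `NumberTheory/Automorphic`; namespace `Literature.NumberTheory.Automorphic`. Theorems only (no
definition, no named fact). Plumbing for the bad-place treatment of Corollaire (i)(b) of
Mœglin–Waldspurger (1989) (the local Rankin–Selberg integral at a bad finite place "is a non-zero
constant", Jacquet–Piatetski-Shapiro–Shalika (1983), (2.7); Cogdell (2004), §4.1: for factorizable data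
`Ψ(s; W, W', Φ) = ∏_v Ψ_v`). On the box `B = 𝕌_Kⁿ × K` (unit ideles in every torus coordinate, `K`
the maximal compact subgroup) with the product `νA ⊗ νK` of Haar measures, consider an integrand
`F(p) · G(p_∞)` where `G` is a continuous function of the archimedean coordinates
`p_∞ = (a_∞, k_∞) ∈ (K_∞ˣ)ⁿ × K_∞` (`archTorusOfIdele`, `kinfOfMaximalCompact`) and the "finite factor"
`F` is measurable, invariant under left multiplication by the archimedean lifts
`(infiniteTorusOfMixed x, maximalCompactOfKinf κ)`, and takes on `B` only the two values `0` and
`F(1)`. Then there is a constant `c ≥ 0`, depending on `F` and the measures only, with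

  `∫_B F(p) G(p_∞) d(νA ⊗ νK) = F(1) · c · ∫ G d(Θ_* νA|_{𝕌ⁿ} ⊗ π_* νK)`

for EVERY continuous `G` (`exists_const_setIntegral_unitBox_two_valued_mul_eq`), and `c ≠ 0` as soon as
`F` does not vanish `νA ⊗ νK`-almost everywhere on `B`. Proof: the image under the archimedean
coordinates of `νA ⊗ νK` restricted to `B ∩ {F ≠ 0}` is a left-invariant measure on
`(K_∞ˣ)ⁿ × K_∞` finite on compacts (every element of the target lifts to an archimedean element of `B`
under which `B`, `{F ≠ 0}` and `νA ⊗ νK` are invariant), hence a scalar multiple of the Haar measure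
`Θ_* νA|_{𝕌ⁿ} ⊗ π_* νK` (`ArchTorusPushforward`; Mathlib's uniqueness of left-invariant measures,
`Measure.isMulLeftInvariant_eq_smul`). [folklore]

## References

* H. Jacquet, I. I. Piatetski-Shapiro, J. A. Shalika, *Rankin–Selberg convolutions*, Amer. J. Math.
  105 (1983), §2, (2.7) [JacquetPiatetskiShapiroShalika1983].
* J. W. Cogdell, *Analytic theory of L-functions for GL_n* (2004), §2.3, §4.1 [CogdellAnalyticTheory2004].
-/

noncomputable section

open MeasureTheory Measure NumberField NumberField.mixedEmbedding IsDedekindDomain Set Filter Topology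
open Literature.NumberTheory.GaloisRepresentations (ideleGroup)
open scoped ENNReal NNReal

namespace Literature.NumberTheory.Automorphic

section Splitting

variable {n : ℕ} {K : Type} [Field K] [NumberField K]

attribute [local instance] adelicBorel borelSpace_adelic locallyCompactSpace_adelic secondCountableTopology_gl_adelic
  glAdeleBorel borelSpace_glAdele glInfBorel borelSpace_glInf locallyCompactSpace_glInf secondCountableTopology_glInf

attribute [local instance] Literature.MeasureTheory.Group.hasSummableGeomSeries_of_finiteDimensional
  Literature.MeasureTheory.Group.Units.borelSpace_of_isOpenEmbedding
  Literature.MeasureTheory.Group.Units.secondCountableTopology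
  Literature.MeasureTheory.Group.Units.locallyCompactSpace

attribute [local instance] secondCountableTopology_ideleGroup borelSpace_pi_mixedUnits measurableMul_pi_mixedUnits

variable [MeasurableSpace (ideleGroup K)] [BorelSpace (ideleGroup K)]

omit [MeasurableSpace (ideleGroup K)] [BorelSpace (ideleGroup K)] in
/-- **The archimedean coordinates of a product with an archimedean lift**: for `y = (x, κ)` in
`(K_∞ˣ)ⁿ × K_∞` and its lift `b = (infiniteTorusOfMixed x, maximalCompactOfKinf κ) ∈ 𝕌_Kⁿ × K`, the
archimedean coordinates of `b p` are `y · (those of p)`. [folklore] -/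
theorem archCoords_lift_mul (y : (Fin n → (mixedSpace K)ˣ) × ↥(Kinf n K))
    (p : (Fin n → ideleGroup K) × ↥(maximalCompactAdelic n K)) :
    (archTorusOfIdele n K (((infiniteTorusOfMixed y.1, maximalCompactOfKinf y.2) :
        (Fin n → ideleGroup K) × ↥(maximalCompactAdelic n K)) * p).1,
      kinfOfMaximalCompact n K (((infiniteTorusOfMixed y.1, maximalCompactOfKinf y.2) :
        (Fin n → ideleGroup K) × ↥(maximalCompactAdelic n K)) * p).2) =
      y * (archTorusOfIdele n K p.1, kinfOfMaximalCompact n K p.2) := by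
  rw [Prod.fst_mul, Prod.snd_mul, map_mul, map_mul, archTorusOfIdele_infiniteTorusOfMixed,
    kinfOfMaximalCompact_maximalCompactOfKinf]
  rfl

omit [MeasurableSpace (ideleGroup K)] [BorelSpace (ideleGroup K)] in
/-- Left multiplication by an element of `𝕌_Kⁿ × K` preserves the box `𝕌_Kⁿ × K`. [folklore] -/
theorem preimage_mul_left_unitBox_univ_prod {b : (Fin n → ideleGroup K) × ↥(maximalCompactAdelic n K)}
    (hb : b.1 ∈ unitBox (n := n) (K := K) (Set.univ : Set (HeightOneSpectrum (𝓞 K)))) :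
    (fun p => b * p) ⁻¹' (unitBox (Set.univ : Set (HeightOneSpectrum (𝓞 K))) ×ˢ
        (Set.univ : Set ↥(maximalCompactAdelic n K))) =
      unitBox (Set.univ : Set (HeightOneSpectrum (𝓞 K))) ×ˢ (Set.univ : Set ↥(maximalCompactAdelic n K)) := by
  ext p
  simp only [Set.mem_preimage, Set.mem_prod, Set.mem_univ, and_true, Prod.fst_mul]
  refine ⟨fun h => ?_, fun h => mul_mem_unitBox_univ hb h⟩
  have := mul_mem_unitBox_univ (inv_mem_unitBox_univ hb) h
  rwa [inv_mul_cancel_left] at this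

/-- **Splitting a two-valued finite factor off the archimedean part of a unit-box torus integral.**
Let `νA`, `νK` be Haar measures on `(𝔸_Kˣ)ⁿ` and `K`, and `F : (𝔸_Kˣ)ⁿ × K → ℂ` measurable, invariant
under left multiplication by the archimedean lifts `(infiniteTorusOfMixed x, maximalCompactOfKinf κ)`,
and taking on `B = 𝕌_Kⁿ × K` only the values `0` and `F(1)`. Then there is `c ≥ 0` such that for every
continuous `G` on `(K_∞ˣ)ⁿ × K_∞`,
`∫_B F(p) G(a_∞, k_∞) d(νA ⊗ νK) = F(1) · c · ∫ G d(Θ_* νA|_{𝕌ⁿ} ⊗ π_* νK)`,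
and `c ≠ 0` whenever `(νA ⊗ νK)(B ∩ {F ≠ 0}) ≠ 0` (uniqueness of left-invariant measures applied to the
image of `(νA ⊗ νK)|_{B ∩ {F ≠ 0}}`). [folklore] -/
theorem exists_const_setIntegral_unitBox_two_valued_mul_eq
    (νA : Measure (Fin n → ideleGroup K)) [IsHaarMeasure νA]
    (νK : Measure ↥(maximalCompactAdelic n K)) [IsHaarMeasure νK]
    {F : (Fin n → ideleGroup K) × ↥(maximalCompactAdelic n K) → ℂ} (hFm : Measurable F)
    (hFarch : ∀ (y : (Fin n → (mixedSpace K)ˣ) × ↥(Kinf n K)) (p : (Fin n → ideleGroup K) × ↥(maximalCompactAdelic n K)),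
      F (((infiniteTorusOfMixed y.1, maximalCompactOfKinf y.2) :
        (Fin n → ideleGroup K) × ↥(maximalCompactAdelic n K)) * p) = F p)
    (hF2 : ∀ p : (Fin n → ideleGroup K) × ↥(maximalCompactAdelic n K),
      p.1 ∈ unitBox (n := n) (K := K) (Set.univ : Set (HeightOneSpectrum (𝓞 K))) → F p = 0 ∨ F p = F 1) :
    ∃ c : ℝ≥0,
      (∀ {G : (Fin n → (mixedSpace K)ˣ) × ↥(Kinf n K) → ℂ}, Continuous G →
        ∫ p in unitBox (Set.univ : Set (HeightOneSpectrum (𝓞 K))) ×ˢ Set.univ,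
            F p * G (archTorusOfIdele n K p.1, kinfOfMaximalCompact n K p.2) ∂(νA.prod νK) =
          F 1 * (c : ℂ) * ∫ q, G q ∂(((νA.restrict (unitBox (Set.univ : Set (HeightOneSpectrum (𝓞 K))))).map
            (archTorusOfIdele n K)).prod (νK.map (kinfOfMaximalCompact n K)))) ∧
      ((νA.prod νK) ((unitBox (Set.univ : Set (HeightOneSpectrum (𝓞 K))) ×ˢ Set.univ) ∩ {p | F p ≠ 0}) ≠ 0 →
        c ≠ 0) := by
  classical
  haveI : CompactSpace ↥(maximalCompactAdelic n K) :=
    isCompact_iff_compactSpace.1 (isCompact_maximalCompactAdelic n K)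
  haveI : CompactSpace ↥(Kinf n K) := isCompact_iff_compactSpace.1 (isCompact_Kinf_holds n K)
  haveI := locallyCompactSpace_ideleGroup K
  haveI hS1 : SecondCountableTopology (Fin n → (mixedSpace K)ˣ) := inferInstance
  haveI hS2 : SecondCountableTopology ↥(Kinf n K) := TopologicalSpace.Subtype.secondCountableTopology _
  haveI hS3 : SecondCountableTopology ((Fin n → (mixedSpace K)ˣ) × ↥(Kinf n K)) := inferInstance
  haveI hB2 : BorelSpace ↥(Kinf n K) := Subtype.borelSpace _
  haveI hB3 : BorelSpace ((Fin n → (mixedSpace K)ˣ) × ↥(Kinf n K)) := Prod.borelSpace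
  haveI hM2 : MeasurableMul ↥(Kinf n K) := inferInstance
  haveI hM3 : MeasurableMul ((Fin n → (mixedSpace K)ˣ) × ↥(Kinf n K)) := inferInstance
  haveI hL3 : LocallyCompactSpace ((Fin n → (mixedSpace K)ˣ) × ↥(Kinf n K)) := inferInstance
  -- notation
  set U : Set (Fin n → ideleGroup K) := unitBox (Set.univ : Set (HeightOneSpectrum (𝓞 K))) with hU
  set B : Set ((Fin n → ideleGroup K) × ↥(maximalCompactAdelic n K)) := U ×ˢ Set.univ with hB
  have hUm : MeasurableSet U := measurableSet_unitBox _
  have hBm : MeasurableSet B := hUm.prod MeasurableSet.univ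
  set σ : (Fin n → ideleGroup K) × ↥(maximalCompactAdelic n K) → (Fin n → (mixedSpace K)ˣ) × ↥(Kinf n K) :=
    fun p => (archTorusOfIdele n K p.1, kinfOfMaximalCompact n K p.2) with hσ
  have hσeq : σ = Prod.map (archTorusOfIdele n K) (kinfOfMaximalCompact n K) := rfl
  have hΘm : Measurable (archTorusOfIdele n K) := continuous_archTorusOfIdele.measurable
  have hπm : Measurable (kinfOfMaximalCompact n K) := continuous_kinfOfMaximalCompact.measurable
  have hσm : Measurable σ := by rw [hσeq]; exact hΘm.prodMap hπm
  set E : Set ((Fin n → ideleGroup K) × ↥(maximalCompactAdelic n K)) := B ∩ {p | F p ≠ 0} with hE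
  have hEm : MeasurableSet E := hBm.inter (hFm (measurableSet_singleton (0 : ℂ)).compl)
  set ν : Measure ((Fin n → ideleGroup K) × ↥(maximalCompactAdelic n K)) := νA.prod νK with hν
  set ρ : Measure ((Fin n → (mixedSpace K)ˣ) × ↥(Kinf n K)) :=
    ((νA.restrict U).map (archTorusOfIdele n K)).prod (νK.map (kinfOfMaximalCompact n K)) with hρ
  haveI hρA : IsHaarMeasure (((νA.restrict U).map (archTorusOfIdele n K)) : Measure (Fin n → (mixedSpace K)ˣ)) :=
    isHaarMeasure_map_archTorusOfIdele νA
  haveI hρK : IsHaarMeasure ((νK.map (kinfOfMaximalCompact n K)) : Measure ↥(Kinf n K)) :=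
    isHaarMeasure_map_kinfOfMaximalCompact νK
  haveI : IsHaarMeasure ρ := by rw [hρ]; infer_instance
  -- `ρ` is the image of `ν|_B`
  have hρeq : (ν.restrict B).map σ = ρ := by
    rw [hρ, Measure.map_prod_map _ _ hΘm hπm, hσeq, hν, hB]
    congr 1
    conv_rhs => rw [← Measure.restrict_univ (μ := νK)]
    rw [Measure.prod_restrict]
  -- the left-invariant measure `λ = σ_* (ν|_E)`
  set lam : Measure ((Fin n → (mixedSpace K)ˣ) × ↥(Kinf n K)) := (ν.restrict E).map σ with hlam
  have hle : lam ≤ ρ := by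
    rw [← hρeq]
    refine Measure.le_iff.2 fun A hA => ?_
    rw [hlam, Measure.map_apply hσm hA, Measure.map_apply hσm hA, Measure.restrict_apply (hσm hA),
      Measure.restrict_apply (hσm hA)]
    exact measure_mono (Set.inter_subset_inter_right _ Set.inter_subset_left)
  haveI hfin : IsFiniteMeasureOnCompacts lam :=
    ⟨fun C hC => lt_of_le_of_lt (hle C) hC.measure_lt_top⟩
  haveI hinv : lam.IsMulLeftInvariant := by
    refine ⟨fun y => ?_⟩
    set b : (Fin n → ideleGroup K) × ↥(maximalCompactAdelic n K) :=
      (infiniteTorusOfMixed y.1, maximalCompactOfKinf y.2) with hb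
    have hbU : b.1 ∈ U := infiniteTorusOfMixed_mem_unitBox y.1
    have hcomp : ((fun z => y * z) ∘ σ) = σ ∘ fun p => b * p := by
      funext p
      simp only [Function.comp_apply, hσ]
      exact (archCoords_lift_mul y p).symm
    have hpreB : (fun p => b * p) ⁻¹' B = B := preimage_mul_left_unitBox_univ_prod hbU
    have hpreE : (fun p => b * p) ⁻¹' E = E := by
      rw [hE, Set.preimage_inter, hpreB]
      congr 1
      ext p
      simp only [Set.mem_preimage, Set.mem_setOf_eq, hb, hFarch y p]
    have hmp : MeasurePreserving (fun p => b * p) ν ν := by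
      have h := (measurePreserving_mul_left νA b.1).prod (measurePreserving_mul_left νK b.2)
      exact h
    rw [hlam, Measure.map_map (measurable_const_mul y) hσm, hcomp, ← Measure.map_map hσm (measurable_const_mul b)]
    congr 1
    conv_lhs => rw [← hpreE]
    rw [← Measure.restrict_map (measurable_const_mul b) hEm, hmp.map_eq]
  -- uniqueness of left-invariant measures
  have hlamρ : lam = haarScalarFactor lam ρ • ρ := Measure.isMulLeftInvariant_eq_smul lam ρ
  refine ⟨haarScalarFactor lam ρ, fun {G} hG => ?_, fun hpos hc => ?_⟩
  · -- the integral identity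
    have hcongr : ∀ p ∈ B, F p * G (σ p) = E.indicator (fun p => F 1 * G (σ p)) p := by
      intro p hp
      rcases hF2 p hp.1 with h0 | h1
      · have hpE : p ∉ E := fun h => h.2 h0
        rw [Set.indicator_of_notMem hpE, h0, zero_mul]
      · by_cases hF0 : F p = 0
        · have hpE : p ∉ E := fun h => h.2 hF0
          rw [Set.indicator_of_notMem hpE, hF0, zero_mul]
        · rw [Set.indicator_of_mem (show p ∈ E from ⟨hp, hF0⟩), h1]
    rw [setIntegral_congr_fun hBm hcongr, setIntegral_indicator hEm,
      show B ∩ E = E from Set.inter_eq_right.2 Set.inter_subset_left, integral_const_mul]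
    have hmapint : ∫ p in E, G (σ p) ∂ν = ∫ q, G q ∂lam := by
      rw [hlam, integral_map hσm.aemeasurable hG.aestronglyMeasurable]
    have hint : ∫ q, G q ∂lam = haarScalarFactor lam ρ • ∫ q, G q ∂ρ := by
      have h := congrArg (fun μ : Measure ((Fin n → (mixedSpace K)ˣ) × ↥(Kinf n K)) => ∫ q, G q ∂μ) hlamρ
      simp only [integral_smul_nnreal_measure] at h
      exact h
    rw [hmapint, hint, NNReal.smul_def, Complex.real_smul, mul_assoc]
  · -- non-vanishing of the constant
    have hzero : lam = 0 := by rw [hlamρ, hc, zero_smul]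
    have h1 : lam Set.univ = ν E := by
      rw [hlam, Measure.map_apply hσm MeasurableSet.univ, Set.preimage_univ, Measure.restrict_apply_univ]
    rw [hzero, Measure.coe_zero, Pi.zero_apply] at h1
    exact hpos h1.symm

end Splitting

end Literature.NumberTheory.Automorphic
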